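import Summits.AtomisticToContinuum.BoseEinsteinCondensation.Theses.BECConjugateDomination
import Summits.AtomisticToContinuum.BoseEinsteinCondensation.Theorems.PuffFloor.Negative.PuffFloorFalseWithoutMinimality
import Summits.AtomisticToContinuum.BoseEinsteinCondensation.Theorems.PuffFloor.Negative.PairCorrelationToolkit
import Literature.MathematicalPhysics.QuantumManyBody.LiebYngvasonCellMethod
import Literature.MathematicalPhysics.QuantumManyBody.TorusFockSectorInteraction
import Literature.MathematicalPhysics.QuantumManyBody.PeriodicBoseGasThm31
import Literature.MathematicalPhysics.QuantumManyBody.PeriodicBoseGasImpurityTranslation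
import Literature.MathematicalPhysics.QuantumManyBody.BoseGasDirichletWall

/-!
# Line `pair-subsolution-removal-energy` for crux `BECConjugateDomination.PuffFloor` (stmt-AtomisticToContinuum-11785)

Crux-plan skeleton, **gen 2** (planner `planner-cruxplan-stmt-AtomisticToContinuum-11785-pair-subsolution-rem-g2-0`,
round 1, 2026-08-16), superseding the gen-1 cut of `…-pair-subsolution-rem-0` (02:18Z; same path — git history
is the revision log; line card `Lines/pair-subsolution-removal-energy.md` §"Gen-2 delta"). Idea card
`Cruxes/PuffFloor/Ideas/pair-subsolution-removal-energy.md`; triage `TRIAGE-r1-{1,2,3}.md`: pass ×3.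

THE LINE. `PuffFloor` (`S_m ≥ |k|/√(|k|² + Cρ)` for positive torus minimisers) is the printed Puff–Feynman
sum-rule chain (`stub_puffFeynmanFloor`: `12T + 2P ≤ ΘN ⇒ S_m ≥ |k|/√(|k|²+Θ)`) fed with `T ≤ E₀ ≤ ρN‖ṽ‖₁`
(constant trial state, PROVED here) and the ONE unprinted input, the soft-edge PAIR MOMENT
`P = E_Ψ[∑_{i<j} W^per(xᵢ−xⱼ)] = O(ρN)`, `W(y) = |y|²‖D²ṽ(y)‖`. This line gets `P` from the NODE
`PairDensityBoundSolid` — bounded bunching `L³ G(r) ≤ C_G` of the translation-averaged pair density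
`G(r) = ∫|Ψ(x+r, x, Y)|²` of the minimiser — through the transfer `P ≤ C(N,2)·(C_G/L³)·‖W‖₁`, PROVED here
(Bose symmetry, unfolding of the periodisation, the shear `(x₀,X') ↦ (x₀+X'₀) :: X'`, Tonelli). The node comes
from the LEVER `stub_pairSubsolution` (`u = √G` is a subsolution of `−2Δ + v^per − μ₂`, `μ₂ = E₀(n+2) − E₀(n)`
the two-particle REMOVAL ENERGY), `stub_removalEnergy` (`μ₂ ≤ (2n+1)‖ṽ‖₁/L³ = O(ρ)`), the transport
`stub_pairDensity_of` (mean value at the maximiser of `u`, free up to the healing length, + a 27-cell count)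
and the CELL SECOND MOMENT `stub_boxSecondMoment` (`∑_c E_Ψ[n_c²] ≤ C N ρℓ³` at one mesoscopic scale, from
the in-tree Lieb–Yngvason cell method + superstability of the positive core, `0 < v 0`). Coreless class
members (`v 0 = 0`) are the scope residual `stub_corelessPairMoment`, SHARED byte-for-byte with the two
sibling lines (no mechanism on file in any line; recommended disposition: tenure restatement `0 < v 0`).
The crux hands `C¹` minimisers; `stub_minimiserRegularity` (SHARED byte-for-byte with both siblings) makes
them `C³` for the lever and for Puff's double commutator.

REGISTERED STUBS (the only `sorry`s; each stated over TREE VOCABULARY ONLY — inlined, no local `def`, no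
`let`, no notation — so that it lands verbatim as a `Theorems/…` file `--supports stmt-AtomisticToContinuum-11785`):
* `stub_minimiserRegularity` (S1, M–L) — SHARED with `coupling-slope-pocket` / `sacrificial-edge-layer`;
* `stub_pairSubsolution`     (S2, L)   — THE LEVER, pointwise, with the abstract `μ₂` (gen-1 verbatim);
* `stub_removalEnergy`       (S3, M)   — `E₀(n+2) ≤ E₀(n) + (2n+1)L⁻³‖ṽ‖₁` (gen-1 verbatim);
* `stub_boxSecondMoment`     (S4, XL)  — cell second moment for SOLID cores `0 < v 0` (gen-1 verbatim);
* `stub_pairDensity_of`      (S5, L)   — transport S2 → S3 → S4 → `PairDensityBoundSolid` (mean value at the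
  maximiser + 27-cell count; typed helper target `SubsolutionMeanValue`); gen-1's transport re-typed for
  solid cores (its coreless input `stub_clusterTail` is retired in favour of the shared, WEAKER S7);
* `stub_puffFeynmanFloor`    (S6, L)   — the printed Puff–Feynman engine, sharp real form (constants 12, 2);
  SHARED byte-for-byte with `coupling-slope-pocket`;
* `stub_corelessPairMoment`  (S7, open scope residual) — SHARED byte-for-byte with both sibling lines.
PROVED HERE (kernel-checked, no `sorry`): `E₀(n+1,L) ≤ ((n+1)²/L³)‖ṽ‖₁` (section `EnergyUpperBound`,
adapted verbatim from `Lines/sacrificial-edge-layer.lean`), `‖ṽ‖₁, ‖W‖₁ < ∞`, Bose symmetry and the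
unfolding of the periodisation for a VECTOR pair weight (adapted from the tree's
`lintegral_cellN_periodicInteraction_mul_symm` / `lintegral_cellN_periodizedPotential_mul`), the pair moment
from the pair-density node (`pairMoment_le_of_pairDensity`), the solid-core pair-moment bound with the index
shift `N = k+2 ↔ n+1`, the case split `v 0 = 0 ∨ 0 < v 0`, the Puff bookkeeping
`12T + 2P ≤ (12‖ṽ‖₁ + 2C_P)ρN`, and the composition `PuffFloor_of : …Theses.BECConjugateDomination.PuffFloor`
— the only theorem of the file concluding the crux, BY NAME.

GEN-2 DELTA (vs gen 1, 7 → 7 stubs): (i) the one-line stub `stub_puffFloor_of : PuffFromPairDensity` (a LOCAL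
NAME as registered signature, hiding the frame bookkeeping and the density→moment step) is REPLACED by the
shared engine S6 + ≈ 400 lines of proved glue; (ii) `stub_clusterTail` (coreless CELL second moment, no
mechanism) is REPLACED by the shared coreless PAIR-MOMENT residual S7 (implied by it; one stub for all three
lines, one tenure restatement moots all three); (iii) `stub_minimiserRegularity` takes the siblings' shared
signature (real, nowhere-zero `(n+1)`-body minimisers — exactly the crux's); (iv) the transport S5 is re-typed
for solid cores; (v) the `Registered.*` aliases are gone — the composition uses the stubs directly.

DISPROOF USED (`Cruxes/PuffFloor/Disproof.lean` v3/v4 + landed `Theorems/PuffFloor/Negative/*`;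
`Negative.PuffFloorFalseWithoutMinimality` and `Negative.PairCorrelationToolkit` are imported):
`puffFloor_false_without_minimality` — HONOURED: exact minimality (`periodicEnergy v Ψ = E₀`) is a
hypothesis of every state-level stub and is SPENT in S2 (Euler–Lagrange equation + slice bound by `E₀(n)`),
S6 (`H − E₀ ≥ 0` as a form and `HΨ = E₀Ψ` in the moment identities), S1 (weak Euler–Lagrange / strict
convexity at the minimum) and S7 (must be: energy cannot give it); `puffFloor_false_for_nearMinimisers` —
RESPECTED: no stub argues by energy-closeness except S4, whose conclusion (cell second moment, solid cores)
is TRUE for all states of energy `≤ CρN`; `puffFloor_tight_at_freeGas` / `puffFloor_holds_at_freeGas` —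
REPRODUCED: `v ≡ 0` is coreless (S7's branch: `W ≡ 0`, `P = 0`) and the composition's constant is
`12‖ṽ‖₁ + 2C_P`. No stub is an instance of a landed Negative lemma (all state-level stubs keep exact
minimality; none is `PuffFloor` with a hypothesis dropped). Negatives index (12; BEC: stmt-3980,
stmt-14490): no contact.
-/

noncomputable section

open MeasureTheory Filter Set Metric
open scoped ENNReal NNReal Topology BigOperators

namespace Summit.AtomisticToContinuum.BoseEinsteinCondensation.Cruxes.PuffFloor.PairSubsolutionRemovalEnergy

open Literature.MathematicalPhysics.QuantumManyBody.BoseGas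
open Summit.AtomisticToContinuum.BoseEinsteinCondensation.Theses.BECConjugateDomination

set_option linter.unusedVariables false

/-! ## Negative knowledge imported (no stub below is an instance of this refuted variant) -/

example : ¬ Theorems.PuffFloor.Negative.PuffFloorWithoutMinimality :=
  Theorems.PuffFloor.Negative.puffFloor_false_without_minimality

/-! ## Objects (for the proved glue only — every registered stub inlines them) -/

/-- Puff's pair weight on separation VECTORS, `W(y) = |y|² ‖D²ṽ(y)‖` (`ṽ(x) = v(|x|)`), `ℝ≥0∞`-valued. -/
def puffWeight (v : ℝ → ℝ≥0∞) (y : Space) : ℝ≥0∞ :=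
  ENNReal.ofReal (‖y‖ ^ 2 * ‖iteratedFDeriv ℝ 2 (fun x : Space => (v ‖x‖).toReal) y‖)

/-- Periodisation of a weight on vectors: `W^per(y) = ∑_{q ∈ ℤ³} W(y − Lq)`. -/
def periodizedWeight (W : Space → ℝ≥0∞) (L : ℝ) (y : Space) : ℝ≥0∞ :=
  ∑' q : Fin 3 → ℤ, W (y - latticeVec L q)

/-- `∑_{i<j} W^per(xᵢ − xⱼ)` of a configuration. -/
def pairWeightSum {N : ℕ} (W : Space → ℝ≥0∞) (L : ℝ) (X : Config N) : ℝ≥0∞ :=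
  ∑ i : Fin N, ∑ j : Fin N with i < j, periodizedWeight W L (X i - X j)

/-! ## Named statements (readable copies; the registered stubs below restate them verbatim) -/

/-- S1 · MINIMISER REGULARITY (triage F2/S2; SHARED byte-for-byte with both sibling lines). For a smooth-class
`v`, every exact minimiser `Ψ` of the periodic `(n+1)`-body energy in the `C¹` periodic Bose class (finite
energy, real, nowhere zero) is `C³`. Why true: EITHER the first variation (symmetrised `C¹` test functions;
`Ψ`, `V^per` symmetric) makes `Ψ` a weak solution of `−ΔΨ = (E₀ − V^per)Ψ` on the torus with `V^per ∈ C²`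
bounded — elliptic regularity (`W^{2,p}`, Schauder `C^{2,α}`, `C^{3,α}`; dimension-free; no Schauder theory
in Mathlib: L); OR the route's support item `PositiveMinimiser` (stmt-AtomisticToContinuum-11787: a `C³`
positive finite-energy minimiser `Ψ₀` exists) plus UNIQUENESS of the nowhere-zero non-negative minimiser
(`Φ = √((Ψ²+Ψ₀²)/2)` is admissible with `E[Φ] = E₀ − ∫|Ψ₀∇Ψ − Ψ∇Ψ₀|²/(2(Ψ²+Ψ₀²))`, so the defect vanishes,
`Ψ/Ψ₀` is constant — technique of `Negative.FreeGasModel.exists_eq_const_of_kinetic_zero` — and `= 1` by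
normalisation: M given 11787). Needed because S2/S4/S5 and S6 want `C³` while the crux hands `C¹` minimisers.
[ReedSimonIV1978 §XIII.12; LSSY2005 Ch. 6 (uniqueness by convexity of `ρ ↦ ∫|∇√ρ|²`); GilbargTrudinger2001 Thm 4.6] -/
def MinimiserRegularity : Prop :=
  ∀ v : ℝ → ℝ≥0∞, IsRepulsiveFiniteRange v → (∀ r, v r ≠ ⊤) →
    ContDiff ℝ 2 (fun x : Space => (v ‖x‖).toReal) →
    (∃ Cₑ : ℝ, ∀ x : Space,
      ‖iteratedFDeriv ℝ 2 (fun x : Space => (v ‖x‖).toReal) x‖ ≤ Cₑ * Real.sqrt ((v ‖x‖).toReal)) →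
    ∀ (n : ℕ) (L : ℝ), 0 < L → ∀ Ψ : PeriodicTrialState (n + 1) L,
      periodicEnergy v Ψ = periodicGroundStateEnergy v (n + 1) L → periodicEnergy v Ψ ≠ ⊤ →
      (∀ X, Ψ.ψ X = (‖Ψ.ψ X‖ : ℂ)) → (∀ X, Ψ.ψ X ≠ 0) → ContDiff ℝ 3 Ψ.ψ

/-- S2 · THE LEVER (pointwise form). For a positive `C³` minimiser `Ψ` of `N = n + 2` bosons on the torus of
side `L`, the square root `u = √G` of the translation-averaged pair density
`G(r) = ∫_{cell^{n+1}} |Ψ(x₂ + r, x₂, x₃, …)|²` (the law of `x₁ - x₂`; `∫_cell G = 1`, `G > 0`, `G ∈ C³`)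
satisfies `-2Δu + (v^per - μ₂) u ≤ 0` on `ℝ³`, `μ₂ := E₀(n+2, L) - E₀(n, L)` the two-particle REMOVAL
energy at the same `L`. Proof (card steps 1–3, re-derived by all three triagers): (1) `HΨ = E₀Ψ` pointwise
(S1-type bootstrap from minimality; here `C³` is a hypothesis) and torus IBP give
`(Δ₁+Δ₂)ρ₂ = 2∫[∑_j |∇_jΨ|² + (V - E₀)Ψ²] dY`; (2) the slice `Y ↦ Ψ(x₁,x₂,Y)/√ρ₂` is an admissible
periodic bosonic `n`-state, so `∫[∑_{j≥3}|∇_jΨ|² + V_YΨ²]dY ≥ E₀(n)ρ₂`, and the cross terms `W ≥ 0` are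
DROPPED (repulsivity used exactly here); (3) translation average, `Δ_rG = ∫Δ₁ρ₂ = ∫Δ₂ρ₂`, Cauchy–Schwarz
`|∇G|² ≤ 4G·K_a` ⇒ `2uΔu ≥ (v^per - μ₂)u²`. `n = 0`: the two-body identity (`E₀(0) = 0`). `v ≡ 0`: `0 ≤ 0`.
Minimality is load-bearing (`Negative.puffFloor_false_without_minimality`): for a mere positive state the
shift is `E(Ψ) - E₀(n) = O(ρN)`, useless. Size L. [LSSY2005 Lemma C.2 (two-body case); Hoffmann-Ostenhof 1977
doi:10.1103/PhysRevA.16.1782 (one-body precedent); card pair-subsolution-removal-energy §Derivation] -/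
def PairSubsolution : Prop :=
  ∀ v : ℝ → ENNReal, IsRepulsiveFiniteRange v → (∀ r, v r ≠ ⊤) → ContDiff ℝ 2 (fun x : Space => (v ‖x‖).toReal) →
  (∃ Cₑ : ℝ, ∀ x : Space, ‖iteratedFDeriv ℝ 2 (fun x : Space => (v ‖x‖).toReal) x‖ ≤
    Cₑ * Real.sqrt ((v ‖x‖).toReal)) →
  ∀ (n : ℕ) (L : ℝ), 0 < L → ∀ Ψ : PeriodicTrialState (n + 2) L,
    periodicEnergy v Ψ = periodicGroundStateEnergy v (n + 2) L → periodicEnergy v Ψ ≠ ⊤ →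
    ContDiff ℝ 3 Ψ.ψ → (∀ X, Ψ.ψ X = (‖Ψ.ψ X‖ : ℂ)) → (∀ X, Ψ.ψ X ≠ 0) →
    ∀ u : Space → ℝ,
      (u = fun r => Real.sqrt (∫ X in cellN (n + 1) L, ‖Ψ.ψ (Matrix.vecCons (X 0 + r) X)‖ ^ 2)) →
      ∀ r : Space,
        -2 * (Laplacian.laplacian u : Space → ℝ) r +
            ((periodizedPotential v L r).toReal -
              ((periodicGroundStateEnergy v (n + 2) L).toReal -
                (periodicGroundStateEnergy v n L).toReal)) * u r ≤ 0

/-- S3 · REMOVAL ENERGY IS `O(ρ)`: `E₀(n+2, L) ≤ E₀(n, L) + (2n+1) L⁻³ ∫_{ℝ³} ṽ`. Trial state (triage r1-2):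
the density mixture `Φ_δ ∝ √(δ + avg_σ |χ ⊗ c ⊗ c ∘ σ|²)` over the `C(n+2,2)` placements of two constant
factors `c = L^{-3/2}` next to any admissible `n`-state `χ` — `C¹`, periodic, symmetric; kinetic energy by
convexity of `ρ ↦ ∫|∇√ρ|²`, interaction `= avg`, and each constant factor interacts with anything by exactly
`L⁻³∫_cell v^per(x - y) dx = L⁻³‖ṽ‖₁` (no condition on the range vs `L`); let `δ → 0`, then `inf` over `χ`.
No "absolute = bosonic ground state" lemma needed. `n = 0`: `E₀(2) ≤ ‖ṽ‖₁/L³`. With `L³ = (n+2)/ρ`: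
`μ₂ ≤ 2ρ‖ṽ‖₁`. Size M. [LSSY2005 Thm 2.2 proof (constant trial factors); LiebSeiringer2009 Thm 3.3] -/
def RemovalEnergyBound : Prop :=
  ∀ v : ℝ → ENNReal, IsRepulsiveFiniteRange v → (∀ r, v r ≠ ⊤) → ContDiff ℝ 2 (fun x : Space => (v ‖x‖).toReal) →
  (∃ Cₑ : ℝ, ∀ x : Space, ‖iteratedFDeriv ℝ 2 (fun x : Space => (v ‖x‖).toReal) x‖ ≤
    Cₑ * Real.sqrt ((v ‖x‖).toReal)) →
  ∀ (n : ℕ) (L : ℝ), 0 < L →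
    periodicGroundStateEnergy v (n + 2) L ≤ periodicGroundStateEnergy v n L +
      ENNReal.ofReal ((2 * (n : ℝ) + 1) / L ^ 3 * ∫ x : Space, (v ‖x‖).toReal)

/-- S4 · `BoxSecondMoment` for SOLID-CORE members (`0 < v 0`; by continuity `v ≥ v(0)/2` on `[0, r_c]`).
Intended proof (card step 7, parameters corrected by triage r1-2/3): state-level cell method
`sum_neumannGroundStateEnergy_mul_le_setLIntegral_cellSet` (LSSY (2.52)) at `ℓ = L/⌊L/ℓ₀⌋`,
`ℓ₀ = a Y^{-β}`, `β ∈ (1/3, 2/5)` (LY's own `6/17`; NOT `2/5`, the Temple boundary), `Y = 4πρa³/3`: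
`E₀(N) = E(Ψ) ≥ E_Ψ[∑_c q(n_c)]` with `q(k) ≥ c₁ a k²/ℓ³` for all `k ≥ K n̄`, from (a) Temple regime
`K n̄ ≤ k ≤ n_T`: `LSSY2005_boxLowerBound_holds` (`lyK ≥ ½` under (2.59)–(2.64)); (b) `n_T < k ≤ n_Y = Y₀ℓ³/a³`:
`LSSY2005_lowerBound_neumann_holds` in the same box at density `k/ℓ³` (condition `C'Y'^{-6/17} < ℓ/a` weakest at
`n_T`, true for small `ρ`); (c) `k > n_Y`: `LSSY2005_superadditivity_holds` (linear, coefficient `πa n_Y/ℓ³`)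
dominating `c a k²/ℓ³` on `[n_Y, n_ss]` with `c = π n_Y/n_ss`, and for `k ≥ n_ss = 2(√3ℓ/r_c)³` SUPERSTABILITY
of the positive core (`∑_{i<j} v ≥ v₁(k²/(2M_s) - k/2)`, kinetic energy dropped) — the only place `0 < v 0`
enters. Then `c₁(a/ℓ³) E_Ψ[∑_c n_c² 1_{n_c ≥ Kn̄}] ≤ E₀ ≤ ρ‖ṽ‖₁N/2` (constant trial state) and the rest is
`≤ K n̄ N`. Uses only `E(Ψ) ≤ CρN` (so it also holds for near-minimisers — consistent with
`Negative.puffFloor_false_for_nearMinimisers`, which is about `S`, not cell counts). `ρℓ₀² = ρ^{1-2β}(…) → 0`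
meets any `ε`. Size XL (LY parameter bookkeeping at all occupations; every analytic input is a `_holds`
theorem in tree). [LSSY2005 (2.52)–(2.64), Thm 2.4; LiebYngvason1998; Ruelle1969 §3.2 (superstability)] -/
def BoxSecondMomentSolidCore : Prop :=
  ∀ v : ℝ → ENNReal, IsRepulsiveFiniteRange v → (∀ r, v r ≠ ⊤) → ContDiff ℝ 2 (fun x : Space => (v ‖x‖).toReal) →
  (∃ Cₑ : ℝ, ∀ x : Space, ‖iteratedFDeriv ℝ 2 (fun x : Space => (v ‖x‖).toReal) x‖ ≤
    Cₑ * Real.sqrt ((v ‖x‖).toReal)) →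
  0 < v 0 →
    ∀ ε : ℝ, 0 < ε → ∃ C : ℝ, 0 ≤ C ∧ ∃ ρ₀ : ℝ, 0 < ρ₀ ∧ ∀ ρ : ℝ, 0 < ρ → ρ < ρ₀ →
      ∀ᶠ n : ℕ in Filter.atTop, ∃ M : ℕ, 0 < M ∧ ρ * (sideLength ρ (n + 2) / (M : ℝ)) ^ 2 ≤ ε ∧
        ∀ Ψ : PeriodicTrialState (n + 2) (sideLength ρ (n + 2)),
          periodicEnergy v Ψ = periodicGroundStateEnergy v (n + 2) (sideLength ρ (n + 2)) →
          periodicEnergy v Ψ ≠ ⊤ → ContDiff ℝ 3 Ψ.ψ → (∀ X, Ψ.ψ X = (‖Ψ.ψ X‖ : ℂ)) →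
          (∀ X, Ψ.ψ X ≠ 0) →
          (∑ σ : Fin (n + 2) → Fin (M ^ 3),
              ((∑ c : Fin (M ^ 3), ((Finset.univ.filter fun i => σ i = c).card) ^ 2 : ℕ) : ENNReal) *
                ∫⁻ X in cellSet M (sideLength ρ (n + 2) / (M : ℝ)) σ, (‖Ψ.ψ X‖₊ : ENNReal) ^ 2) ≤
            ENNReal.ofReal (C * ((n : ℝ) + 2) ^ 2 / (M : ℝ) ^ 3)

/-- THE NODE (bounded bunching below the healing length; SOLID cores): for every smooth-class `v` with
`0 < v 0` there are `C, ρ₀` with `L³ G(r) ≤ C` at EVERY separation `r`, eventually in `n`, for every positive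
`C³` minimiser on the torus of side `L = sideLength ρ (n+2)` (`G(r) = ∫_{cell^{n+1}} |Ψ(X₀ + r, X₀, X₁, …)|²`,
uncorrelated value `L⁻³`). One lemma, three consumers: this crux (via the proved transfer and S6),
`StructureFactorFloor` (stmt-AtomisticToContinuum-12228, route BECPalmDirectCorrelation) and the a-priori
`sup g₂ < ∞` of BECLiebAntibunching / BECRieszShadow. Not a stub: it is the conclusion of S5. Gen 1 stated it
for all smooth-class `v`; the coreless half had no mechanism (its planted-cluster witness shows energy cannot
give the cell second moment) and is now carried, at the weaker pair-moment level, by the shared residual S7.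
[card pair-subsolution-removal-energy; TRIAGE-r1-2 note (dominance), r1-1 §1 / r1-3 S1 (scope)] -/
def PairDensityBoundSolid : Prop :=
  ∀ v : ℝ → ENNReal, IsRepulsiveFiniteRange v → (∀ r, v r ≠ ⊤) → ContDiff ℝ 2 (fun x : Space => (v ‖x‖).toReal) →
  (∃ Cₑ : ℝ, ∀ x : Space, ‖iteratedFDeriv ℝ 2 (fun x : Space => (v ‖x‖).toReal) x‖ ≤
    Cₑ * Real.sqrt ((v ‖x‖).toReal)) →
  0 < v 0 →
  ∃ C : ℝ, 0 ≤ C ∧ ∃ ρ₀ : ℝ, 0 < ρ₀ ∧ ∀ ρ : ℝ, 0 < ρ → ρ < ρ₀ →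
    ∀ᶠ n : ℕ in Filter.atTop, ∀ Ψ : PeriodicTrialState (n + 2) (sideLength ρ (n + 2)),
      periodicEnergy v Ψ = periodicGroundStateEnergy v (n + 2) (sideLength ρ (n + 2)) →
      periodicEnergy v Ψ ≠ ⊤ → ContDiff ℝ 3 Ψ.ψ → (∀ X, Ψ.ψ X = (‖Ψ.ψ X‖ : ℂ)) →
      (∀ X, Ψ.ψ X ≠ 0) →
      ∀ r : Space,
        sideLength ρ (n + 2) ^ 3 *
            (∫ X in cellN (n + 1) (sideLength ρ (n + 2)), ‖Ψ.ψ (Matrix.vecCons (X 0 + r) X)‖ ^ 2) ≤ C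

/-- S5 · TRANSPORT (card steps 5–6; gen-1's S6 re-typed for solid cores): the lever + the removal-energy bound +
the solid-core cell second moment give the node. Proof: fix `v` with `0 < v 0`; `ε := 4/max(1,‖ṽ‖₁)`, take
`C_B, ρ₀` from the third hypothesis; for `ρ < ρ₀`, eventually in `n`, a grid `M` with `ρ(L/M)² ≤ ε`; for a
positive `C³` minimiser: `u = √G ∈ C²`, periodic, so it has a global maximiser `x*`; by S2 and `v^per u ≥ 0`,
`−Δu ≤ λu` with `λ = μ₂/2 ≤ ρ‖ṽ‖₁` (S3 and `(2n+1)/L³ ≤ 2ρ`); `SubsolutionMeanValue` (typed below) on `B_R(x*)`,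
`R = L/(2M)`, `λR² ≤ ‖ṽ‖₁ε/4 ≤ 1`, and Jensen give `max G ≤ C₀² |B_R|⁻¹ ∫_{B_R(x*)} G`; unfolding `G` by
periodicity, `∫_{B_R(x*)}G = P_{|Ψ|²}(x₁ − x₂ ∈ B_R(x*) + Lℤ³) = (N(N−1))⁻¹ E #{(i≠j) : xᵢ − xⱼ ∈ B_R(x*) + Lℤ³}`
(Bose symmetry), and on `cellSet M ℓ σ` such a pair has `(σ i, σ j)` among `≤ 27` neighbouring cell pairs
determined by `x*` (`R ≤ ℓ/2`), so by `ab ≤ (a²+b²)/2` the count is `≤ 27 ∑_σ (∑_c n_c(σ)²)·mass(σ) ≤ 27 C_B N²/M³`;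
with `|B_R| = πL³/(6M³)`: `L³ max G ≤ C₀²·27·C_B·(6/π)·N/(N−1)`. Size L (Mathlib has the Laplacian but no
mean-value inequality on balls of `EuclideanSpace ℝ (Fin 3)`; land `SubsolutionMeanValue` as a `--supports`
helper). [GilbargTrudinger2001 Thm 2.1; card steps 5–6; TRIAGE-r1-2 §A, TRIAGE-r1-3 (5)–(6)] -/
def PairDensityTransportSolid : Prop :=
  PairSubsolution → RemovalEnergyBound → BoxSecondMomentSolidCore → PairDensityBoundSolid

/-- S6 · THE PUFF–FEYNMAN ENGINE (printed sum-rule chain, sharp real form; triage S4/G1; SHARED byte-for-byte with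
`coupling-slope-pocket`). For a `C³` real exact minimiser `Ψ` of the periodic `(n+1)`-body energy (torus of side
`L > 0`): if `12·T + 2·P ≤ Θ·(n+1)` with `T = ∫|∇Ψ|²` and `P = ∫ ∑_{i<j} W^per(xᵢ−xⱼ)|Ψ|²`,
`W^per(y) = ∑_q |y−Lq|²‖D²ṽ(y−Lq)‖`, then `S_m ≥ |k|/√(|k|² + Θ)` for every `m ≠ 0`. Why true: with
`G = ρ_k† = ∑ⱼ e_m(xⱼ)`, `A = [H,G] = ∑ⱼ e_m(xⱼ)(|k|² − 2ik·∇ⱼ)` and the form `q = E[·] − E₀‖·‖² ≥ 0` on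
symmetric periodic `C¹` functions (minimality): `m₀ = N S_m`, `m₁ = q(GΨ) = N|k|²` (f-sum, real `Ψ`),
`m₂ = ‖AΨ‖² = q(GΨ, AΨ)`, `m₃ = q(AΨ)`; Cauchy–Schwarz twice gives `m₁³ ≤ m₀²m₃`; Puff's double commutator
(strong eigen-equation, `Ψ ∈ C³`, real): `m₃ = N|k|⁶ + 12|k|⁴∑ⱼ‖(k̂·∇ⱼ)Ψ‖² + 4E_Ψ[∑_{i<j}(1 − cos k·xᵢⱼ)(k·∇)²ṽ^per(xᵢⱼ)]
≤ N|k|⁴(|k|² + (12T + 2P)/N)` — re-derived by this seat: the `l ≠ j` terms of `[A†,[T,A]]` vanish, the one-body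
term is `(2κP+κ²)³ − (2κP−κ²)³ = 24κ⁴P² + 2κ⁶`, the potential term is `4∑_{i<j}(1−cos)(k·∇)²v` with
`1 − cos ≤ |k|²|y−Lq|²/2` image by image and `|(k·∇)²ṽ| ≤ |k|²‖D²ṽ‖` — so the constants 12 and 2 are right.
Companion of sibling stmt-12618 (`CurrentSumRule`, same `M₃`). Size L.
[Puff1965; Stringari1995 §2.3 (20)–(23) (book:griffin1995 p. 77); Lipparini2008 (8.64),(8.66),(10.80);
doi:10.1103/physrevb.46.2974; Feynman1954; tree `groundStateDirichletForm_planeWaveSum`] -/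
def PuffFeynmanFloor : Prop :=
  ∀ v : ℝ → ℝ≥0∞, IsRepulsiveFiniteRange v → (∀ r, v r ≠ ⊤) →
    ContDiff ℝ 2 (fun x : Space => (v ‖x‖).toReal) →
    ∀ n : ℕ, ∀ L : ℝ, 0 < L → ∀ Ψ : PeriodicTrialState (n + 1) L, ContDiff ℝ 3 Ψ.ψ →
      periodicEnergy v Ψ = periodicGroundStateEnergy v (n + 1) L → periodicEnergy v Ψ ≠ ⊤ →
      (∀ X, Ψ.ψ X = (‖Ψ.ψ X‖ : ℂ)) →
      ∀ Θ : ℝ, 0 ≤ Θ →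
        12 * (∫⁻ X in cellN (n + 1) L, kineticDensity Ψ.ψ X) +
            2 * (∫⁻ X in cellN (n + 1) L,
              (∑ i : Fin (n + 1), ∑ j : Fin (n + 1) with i < j, ∑' q : Fin 3 → ℤ,
              ENNReal.ofReal (‖X i - X j - latticeVec L q‖ ^ 2 *
                ‖iteratedFDeriv ℝ 2 (fun y : Space => (v ‖y‖).toReal)
                  (X i - X j - latticeVec L q)‖)) *
                (‖Ψ.ψ X‖₊ : ℝ≥0∞) ^ 2)
          ≤ ENNReal.ofReal (Θ * ((n : ℝ) + 1)) →
        ∀ m : Fin 3 → ℤ, m ≠ 0 →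
          ‖(2 * Real.pi / L) • latticeVec 1 m‖ /
              Real.sqrt (‖(2 * Real.pi / L) • latticeVec 1 m‖ ^ 2 + Θ)
            ≤ ((n : ℝ) + 1)⁻¹ *
                ∫ X in cellN (n + 1) L, ‖∑ j : Fin (n + 1), cellWave L m (X j)‖ ^ 2 * ‖Ψ.ψ X‖ ^ 2

/-- S7 · THE SCOPE RESIDUAL (SHARED byte-for-byte with both sibling lines) — the pair-moment bound for CORELESS
members (`v 0 = 0`: hollow shells, `ṽ = O(r⁴)` members; the smooth class admits them, triage S1/F1): for the
EXACT positive minimiser, `P ≤ CρN` eventually in `n`. It is implied by (and weaker than) gen-1's cell-form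
residual `ClusterTail` via S5's transport and the proved transfer. Why plausibly true: `v ≥ 0` forbids
clustering; `g₂ ≈ f₀²` with `f₀ ≤ 1` constant inside a hollow core, so `P ≈ ½Nρ∫W f₀² ≤ ½ρN‖W‖₁`; `v ≡ 0`:
`W ≡ 0`, `P = 0` (`Negative.FreeGasModel`). Why it is the residual: every ENERGY-based argument is void here —
planting four tight clusters of `m ≍ (ρN)^{1/2}ε^{−3/2}` particles inside the gas costs `≤ ερN` but makes
`P ≫ ρN` (card COVERAGE; cards 2–4 give the same witness), so any proof must use the exact-eigenfunction
structure a second time (candidate tools on the line card: the `m`-body lever `√ρ_m` subsolution at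
`μ_m ≤ 2mρ‖ṽ‖₁` — its trivial-mass bound is useless, `sup ρ_m ≤ C_m μ_m^{3m/2}` does not decay with `L`;
heat-flow comparison with the PRODUCT kernel; large deviations of healing-ball counts). RECOMMENDED
DISPOSITION (lead → tenure planner): restate the route's smooth class with `0 < v 0` (PuffFloor, IMU, supports
and the hypothesis of HardCoreExtension — physically immaterial); then S7 and the case split disappear in all
three lines at once. Size: open. [LSSY2005 Ch. 2; card pair-subsolution-removal-energy §COVERAGE; TRIAGE-r1-1 §1] -/
def CorelessPairMoment : Prop :=
  ∀ v : ℝ → ℝ≥0∞, IsRepulsiveFiniteRange v → (∀ r, v r ≠ ⊤) →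
    ContDiff ℝ 2 (fun x : Space => (v ‖x‖).toReal) →
    (∃ Cₑ : ℝ, ∀ x : Space,
      ‖iteratedFDeriv ℝ 2 (fun x : Space => (v ‖x‖).toReal) x‖ ≤ Cₑ * Real.sqrt ((v ‖x‖).toReal)) →
    v 0 = 0 →
    ∃ C : ℝ, 0 ≤ C ∧ ∃ ρ₀ : ℝ, 0 < ρ₀ ∧ ∀ ρ : ℝ, 0 < ρ → ρ < ρ₀ → ∀ᶠ n : ℕ in Filter.atTop,
      ∀ Ψ : PeriodicTrialState (n + 1) (sideLength ρ (n + 1)),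
        periodicEnergy v Ψ = periodicGroundStateEnergy v (n + 1) (sideLength ρ (n + 1)) →
        periodicEnergy v Ψ ≠ ⊤ → (∀ X, Ψ.ψ X = (‖Ψ.ψ X‖ : ℂ)) → (∀ X, Ψ.ψ X ≠ 0) →
        (∫⁻ X in cellN (n + 1) (sideLength ρ (n + 1)),
            (∑ i : Fin (n + 1), ∑ j : Fin (n + 1) with i < j, ∑' q : Fin 3 → ℤ,
              ENNReal.ofReal (‖X i - X j - latticeVec (sideLength ρ (n + 1)) q‖ ^ 2 *
                ‖iteratedFDeriv ℝ 2 (fun y : Space => (v ‖y‖).toReal)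
                  (X i - X j - latticeVec (sideLength ρ (n + 1)) q)‖)) *
              (‖Ψ.ψ X‖₊ : ℝ≥0∞) ^ 2) ≤
          ENNReal.ofReal (C * ρ * ((n : ℝ) + 1))

/-- Typed HELPER target for the prover of S6 (not a registered stub): interior mean-value inequality for
non-negative `C²` subsolutions of `Δu + λu ≥ 0` on a ball of `ℝ³` with `λR² ≤ 1` — TRUE at a general centre
(triage r1-2: Gronwall on spherical means; r1-3: `u·e^{√λ t}` is subharmonic on `B_R ⊂ ℝ⁴`, `C₀ = 16e/(3π)`); at a
maximiser the elementary constant is `(1 - λR²/10)⁻¹ ≤ 10/9`. [GilbargTrudinger2001 Thm 2.1; card step 5] -/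
def SubsolutionMeanValue : Prop :=
  ∃ C₀ : ℝ, ∀ (u : Space → ℝ) (x₀ : Space) (R lam : ℝ),
    0 < R → 0 ≤ lam → lam * R ^ 2 ≤ 1 → ContDiff ℝ 2 u → (∀ x, 0 ≤ u x) →
    (∀ x ∈ Metric.ball x₀ R, -(Laplacian.laplacian u : Space → ℝ) x ≤ lam * u x) →
    u x₀ ≤ C₀ * (volume (Metric.ball x₀ R)).toReal⁻¹ * ∫ x in Metric.ball x₀ R, u x


/-! ## Registered stubs (`sorry` lives only in these seven theorems; statements inlined) -/

/-- **S1 — minimiser regularity** `= MinimiserRegularity` verbatim (see its docstring); SHARED signature with both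
sibling lines. Size M–L. -/
theorem stub_minimiserRegularity :
    ∀ v : ℝ → ℝ≥0∞, IsRepulsiveFiniteRange v → (∀ r, v r ≠ ⊤) →
      ContDiff ℝ 2 (fun x : Space => (v ‖x‖).toReal) →
      (∃ Cₑ : ℝ, ∀ x : Space,
        ‖iteratedFDeriv ℝ 2 (fun x : Space => (v ‖x‖).toReal) x‖ ≤ Cₑ * Real.sqrt ((v ‖x‖).toReal)) →
      ∀ (n : ℕ) (L : ℝ), 0 < L → ∀ Ψ : PeriodicTrialState (n + 1) L,
        periodicEnergy v Ψ = periodicGroundStateEnergy v (n + 1) L → periodicEnergy v Ψ ≠ ⊤ →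
        (∀ X, Ψ.ψ X = (‖Ψ.ψ X‖ : ℂ)) → (∀ X, Ψ.ψ X ≠ 0) → ContDiff ℝ 3 Ψ.ψ := by
  sorry


/-- **S2 — the lever** `= PairSubsolution` verbatim (see its docstring; gen-1 stub, unchanged). Size L. -/
theorem stub_pairSubsolution :
    ∀ v : ℝ → ENNReal, IsRepulsiveFiniteRange v → (∀ r, v r ≠ ⊤) → ContDiff ℝ 2 (fun x : Space => (v ‖x‖).toReal) →
    (∃ Cₑ : ℝ, ∀ x : Space, ‖iteratedFDeriv ℝ 2 (fun x : Space => (v ‖x‖).toReal) x‖ ≤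
      Cₑ * Real.sqrt ((v ‖x‖).toReal)) →
    ∀ (n : ℕ) (L : ℝ), 0 < L → ∀ Ψ : PeriodicTrialState (n + 2) L,
      periodicEnergy v Ψ = periodicGroundStateEnergy v (n + 2) L → periodicEnergy v Ψ ≠ ⊤ →
      ContDiff ℝ 3 Ψ.ψ → (∀ X, Ψ.ψ X = (‖Ψ.ψ X‖ : ℂ)) → (∀ X, Ψ.ψ X ≠ 0) →
      ∀ u : Space → ℝ,
        (u = fun r => Real.sqrt (∫ X in cellN (n + 1) L, ‖Ψ.ψ (Matrix.vecCons (X 0 + r) X)‖ ^ 2)) →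
        ∀ r : Space,
          -2 * (Laplacian.laplacian u : Space → ℝ) r +
              ((periodizedPotential v L r).toReal -
                ((periodicGroundStateEnergy v (n + 2) L).toReal -
                  (periodicGroundStateEnergy v n L).toReal)) * u r ≤ 0 := by
  sorry


/-- **S3** `= RemovalEnergyBound` verbatim (see its docstring; gen-1 stub, unchanged). Size M. -/
theorem stub_removalEnergy :
    ∀ v : ℝ → ENNReal, IsRepulsiveFiniteRange v → (∀ r, v r ≠ ⊤) → ContDiff ℝ 2 (fun x : Space => (v ‖x‖).toReal) →
    (∃ Cₑ : ℝ, ∀ x : Space, ‖iteratedFDeriv ℝ 2 (fun x : Space => (v ‖x‖).toReal) x‖ ≤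
      Cₑ * Real.sqrt ((v ‖x‖).toReal)) →
    ∀ (n : ℕ) (L : ℝ), 0 < L →
      periodicGroundStateEnergy v (n + 2) L ≤ periodicGroundStateEnergy v n L +
        ENNReal.ofReal ((2 * (n : ℝ) + 1) / L ^ 3 * ∫ x : Space, (v ‖x‖).toReal) := by
  sorry


/-- **S4 — hardest stub with a mechanism** `= BoxSecondMomentSolidCore` verbatim (see its docstring; gen-1 stub,
unchanged). Size XL. -/
theorem stub_boxSecondMoment :
    ∀ v : ℝ → ENNReal, IsRepulsiveFiniteRange v → (∀ r, v r ≠ ⊤) → ContDiff ℝ 2 (fun x : Space => (v ‖x‖).toReal) →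
    (∃ Cₑ : ℝ, ∀ x : Space, ‖iteratedFDeriv ℝ 2 (fun x : Space => (v ‖x‖).toReal) x‖ ≤
      Cₑ * Real.sqrt ((v ‖x‖).toReal)) →
    0 < v 0 →
      ∀ ε : ℝ, 0 < ε → ∃ C : ℝ, 0 ≤ C ∧ ∃ ρ₀ : ℝ, 0 < ρ₀ ∧ ∀ ρ : ℝ, 0 < ρ → ρ < ρ₀ →
        ∀ᶠ n : ℕ in Filter.atTop, ∃ M : ℕ, 0 < M ∧ ρ * (sideLength ρ (n + 2) / (M : ℝ)) ^ 2 ≤ ε ∧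
          ∀ Ψ : PeriodicTrialState (n + 2) (sideLength ρ (n + 2)),
            periodicEnergy v Ψ = periodicGroundStateEnergy v (n + 2) (sideLength ρ (n + 2)) →
            periodicEnergy v Ψ ≠ ⊤ → ContDiff ℝ 3 Ψ.ψ → (∀ X, Ψ.ψ X = (‖Ψ.ψ X‖ : ℂ)) →
            (∀ X, Ψ.ψ X ≠ 0) →
            (∑ σ : Fin (n + 2) → Fin (M ^ 3),
                ((∑ c : Fin (M ^ 3), ((Finset.univ.filter fun i => σ i = c).card) ^ 2 : ℕ) : ENNReal) *
                  ∫⁻ X in cellSet M (sideLength ρ (n + 2) / (M : ℝ)) σ, (‖Ψ.ψ X‖₊ : ENNReal) ^ 2) ≤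
              ENNReal.ofReal (C * ((n : ℝ) + 2) ^ 2 / (M : ℝ) ^ 3) := by
  sorry


/-- **S5 — transport** `= PairDensityTransportSolid` with every hypothesis inlined (see its docstring): hypothesis 1
is S2's statement, hypothesis 2 is S3's, hypothesis 3 is S4's (solid cores), the conclusion is the node
`PairDensityBoundSolid`. Size L. -/
theorem stub_pairDensity_of :
    (∀ v : ℝ → ENNReal, IsRepulsiveFiniteRange v → (∀ r, v r ≠ ⊤) → ContDiff ℝ 2 (fun x : Space => (v ‖x‖).toReal) →
    (∃ Cₑ : ℝ, ∀ x : Space, ‖iteratedFDeriv ℝ 2 (fun x : Space => (v ‖x‖).toReal) x‖ ≤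
      Cₑ * Real.sqrt ((v ‖x‖).toReal)) →
    ∀ (n : ℕ) (L : ℝ), 0 < L → ∀ Ψ : PeriodicTrialState (n + 2) L,
      periodicEnergy v Ψ = periodicGroundStateEnergy v (n + 2) L → periodicEnergy v Ψ ≠ ⊤ →
      ContDiff ℝ 3 Ψ.ψ → (∀ X, Ψ.ψ X = (‖Ψ.ψ X‖ : ℂ)) → (∀ X, Ψ.ψ X ≠ 0) →
      ∀ u : Space → ℝ,
        (u = fun r => Real.sqrt (∫ X in cellN (n + 1) L, ‖Ψ.ψ (Matrix.vecCons (X 0 + r) X)‖ ^ 2)) →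
        ∀ r : Space,
          -2 * (Laplacian.laplacian u : Space → ℝ) r +
              ((periodizedPotential v L r).toReal -
                ((periodicGroundStateEnergy v (n + 2) L).toReal -
                  (periodicGroundStateEnergy v n L).toReal)) * u r ≤ 0) →
    (∀ v : ℝ → ENNReal, IsRepulsiveFiniteRange v → (∀ r, v r ≠ ⊤) → ContDiff ℝ 2 (fun x : Space => (v ‖x‖).toReal) →
    (∃ Cₑ : ℝ, ∀ x : Space, ‖iteratedFDeriv ℝ 2 (fun x : Space => (v ‖x‖).toReal) x‖ ≤
      Cₑ * Real.sqrt ((v ‖x‖).toReal)) →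
    ∀ (n : ℕ) (L : ℝ), 0 < L →
      periodicGroundStateEnergy v (n + 2) L ≤ periodicGroundStateEnergy v n L +
        ENNReal.ofReal ((2 * (n : ℝ) + 1) / L ^ 3 * ∫ x : Space, (v ‖x‖).toReal)) →
    (∀ v : ℝ → ENNReal, IsRepulsiveFiniteRange v → (∀ r, v r ≠ ⊤) → ContDiff ℝ 2 (fun x : Space => (v ‖x‖).toReal) →
    (∃ Cₑ : ℝ, ∀ x : Space, ‖iteratedFDeriv ℝ 2 (fun x : Space => (v ‖x‖).toReal) x‖ ≤
      Cₑ * Real.sqrt ((v ‖x‖).toReal)) →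
    0 < v 0 →
      ∀ ε : ℝ, 0 < ε → ∃ C : ℝ, 0 ≤ C ∧ ∃ ρ₀ : ℝ, 0 < ρ₀ ∧ ∀ ρ : ℝ, 0 < ρ → ρ < ρ₀ →
        ∀ᶠ n : ℕ in Filter.atTop, ∃ M : ℕ, 0 < M ∧ ρ * (sideLength ρ (n + 2) / (M : ℝ)) ^ 2 ≤ ε ∧
          ∀ Ψ : PeriodicTrialState (n + 2) (sideLength ρ (n + 2)),
            periodicEnergy v Ψ = periodicGroundStateEnergy v (n + 2) (sideLength ρ (n + 2)) →
            periodicEnergy v Ψ ≠ ⊤ → ContDiff ℝ 3 Ψ.ψ → (∀ X, Ψ.ψ X = (‖Ψ.ψ X‖ : ℂ)) →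
            (∀ X, Ψ.ψ X ≠ 0) →
            (∑ σ : Fin (n + 2) → Fin (M ^ 3),
                ((∑ c : Fin (M ^ 3), ((Finset.univ.filter fun i => σ i = c).card) ^ 2 : ℕ) : ENNReal) *
                  ∫⁻ X in cellSet M (sideLength ρ (n + 2) / (M : ℝ)) σ, (‖Ψ.ψ X‖₊ : ENNReal) ^ 2) ≤
              ENNReal.ofReal (C * ((n : ℝ) + 2) ^ 2 / (M : ℝ) ^ 3)) →
    ∀ v : ℝ → ENNReal, IsRepulsiveFiniteRange v → (∀ r, v r ≠ ⊤) → ContDiff ℝ 2 (fun x : Space => (v ‖x‖).toReal) →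
    (∃ Cₑ : ℝ, ∀ x : Space, ‖iteratedFDeriv ℝ 2 (fun x : Space => (v ‖x‖).toReal) x‖ ≤
      Cₑ * Real.sqrt ((v ‖x‖).toReal)) →
    0 < v 0 →
    ∃ C : ℝ, 0 ≤ C ∧ ∃ ρ₀ : ℝ, 0 < ρ₀ ∧ ∀ ρ : ℝ, 0 < ρ → ρ < ρ₀ →
      ∀ᶠ n : ℕ in Filter.atTop, ∀ Ψ : PeriodicTrialState (n + 2) (sideLength ρ (n + 2)),
        periodicEnergy v Ψ = periodicGroundStateEnergy v (n + 2) (sideLength ρ (n + 2)) →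
        periodicEnergy v Ψ ≠ ⊤ → ContDiff ℝ 3 Ψ.ψ → (∀ X, Ψ.ψ X = (‖Ψ.ψ X‖ : ℂ)) →
        (∀ X, Ψ.ψ X ≠ 0) →
        ∀ r : Space,
          sideLength ρ (n + 2) ^ 3 *
              (∫ X in cellN (n + 1) (sideLength ρ (n + 2)), ‖Ψ.ψ (Matrix.vecCons (X 0 + r) X)‖ ^ 2) ≤ C := by
  sorry

/-- **S6 — the Puff–Feynman engine** `= PuffFeynmanFloor` verbatim (see its docstring); SHARED signature with
`coupling-slope-pocket`. Size L. -/
theorem stub_puffFeynmanFloor :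
    ∀ v : ℝ → ℝ≥0∞, IsRepulsiveFiniteRange v → (∀ r, v r ≠ ⊤) →
      ContDiff ℝ 2 (fun x : Space => (v ‖x‖).toReal) →
      ∀ n : ℕ, ∀ L : ℝ, 0 < L → ∀ Ψ : PeriodicTrialState (n + 1) L, ContDiff ℝ 3 Ψ.ψ →
        periodicEnergy v Ψ = periodicGroundStateEnergy v (n + 1) L → periodicEnergy v Ψ ≠ ⊤ →
        (∀ X, Ψ.ψ X = (‖Ψ.ψ X‖ : ℂ)) →
        ∀ Θ : ℝ, 0 ≤ Θ →
          12 * (∫⁻ X in cellN (n + 1) L, kineticDensity Ψ.ψ X) +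
              2 * (∫⁻ X in cellN (n + 1) L,
                (∑ i : Fin (n + 1), ∑ j : Fin (n + 1) with i < j, ∑' q : Fin 3 → ℤ,
                ENNReal.ofReal (‖X i - X j - latticeVec L q‖ ^ 2 *
                  ‖iteratedFDeriv ℝ 2 (fun y : Space => (v ‖y‖).toReal)
                    (X i - X j - latticeVec L q)‖)) *
                  (‖Ψ.ψ X‖₊ : ℝ≥0∞) ^ 2)
            ≤ ENNReal.ofReal (Θ * ((n : ℝ) + 1)) →
          ∀ m : Fin 3 → ℤ, m ≠ 0 →
            ‖(2 * Real.pi / L) • latticeVec 1 m‖ /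
                Real.sqrt (‖(2 * Real.pi / L) • latticeVec 1 m‖ ^ 2 + Θ)
              ≤ ((n : ℝ) + 1)⁻¹ *
                  ∫ X in cellN (n + 1) L, ‖∑ j : Fin (n + 1), cellWave L m (X j)‖ ^ 2 * ‖Ψ.ψ X‖ ^ 2 := by
  sorry


/-- **S7 — the scope residual (no mechanism on file)** `= CorelessPairMoment` verbatim (see its docstring); SHARED
signature with both sibling lines. Size: open. -/
theorem stub_corelessPairMoment :
    ∀ v : ℝ → ℝ≥0∞, IsRepulsiveFiniteRange v → (∀ r, v r ≠ ⊤) →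
      ContDiff ℝ 2 (fun x : Space => (v ‖x‖).toReal) →
      (∃ Cₑ : ℝ, ∀ x : Space,
        ‖iteratedFDeriv ℝ 2 (fun x : Space => (v ‖x‖).toReal) x‖ ≤ Cₑ * Real.sqrt ((v ‖x‖).toReal)) →
      v 0 = 0 →
      ∃ C : ℝ, 0 ≤ C ∧ ∃ ρ₀ : ℝ, 0 < ρ₀ ∧ ∀ ρ : ℝ, 0 < ρ → ρ < ρ₀ → ∀ᶠ n : ℕ in Filter.atTop,
        ∀ Ψ : PeriodicTrialState (n + 1) (sideLength ρ (n + 1)),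
          periodicEnergy v Ψ = periodicGroundStateEnergy v (n + 1) (sideLength ρ (n + 1)) →
          periodicEnergy v Ψ ≠ ⊤ → (∀ X, Ψ.ψ X = (‖Ψ.ψ X‖ : ℂ)) → (∀ X, Ψ.ψ X ≠ 0) →
          (∫⁻ X in cellN (n + 1) (sideLength ρ (n + 1)),
              (∑ i : Fin (n + 1), ∑ j : Fin (n + 1) with i < j, ∑' q : Fin 3 → ℤ,
                ENNReal.ofReal (‖X i - X j - latticeVec (sideLength ρ (n + 1)) q‖ ^ 2 *
                  ‖iteratedFDeriv ℝ 2 (fun y : Space => (v ‖y‖).toReal)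
                    (X i - X j - latticeVec (sideLength ρ (n + 1)) q)‖)) *
                (‖Ψ.ψ X‖₊ : ℝ≥0∞) ^ 2) ≤
            ENNReal.ofReal (C * ρ * ((n : ℝ) + 1)) := by
  sorry



/-! ### Consistency: each named statement IS its registered stub (definitionally) -/

theorem minimiserRegularity_holds : MinimiserRegularity := stub_minimiserRegularity
theorem pairSubsolution_holds : PairSubsolution := stub_pairSubsolution
theorem removalEnergyBound_holds : RemovalEnergyBound := stub_removalEnergy
theorem boxSecondMomentSolidCore_holds : BoxSecondMomentSolidCore := stub_boxSecondMoment
theorem pairDensityTransportSolid_holds : PairDensityTransportSolid := stub_pairDensity_of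
theorem puffFeynmanFloor_holds : PuffFeynmanFloor := stub_puffFeynmanFloor
theorem corelessPairMoment_holds : CorelessPairMoment := stub_corelessPairMoment

/-! ## Proved glue (kernel-checked; nothing is admitted below this line) -/

/-- **The node for solid cores** from the stubs S2, S3, S4 through the transport S5. -/
theorem pairDensityBoundSolid : PairDensityBoundSolid :=
  pairDensityTransportSolid_holds pairSubsolution_holds removalEnergyBound_holds boxSecondMomentSolidCore_holds

/-! ## Proved: `E₀^per(N, L) ≤ (N²/L³) ∫ṽ` (constant trial state; adapted verbatim from
`Lines/sacrificial-edge-layer.lean`, planner …-sacrificial-edge-lay-0) -/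

section EnergyUpperBound

variable {v : ℝ → ℝ≥0∞}

private theorem measurable_periodizedPotential' (hv : Measurable v) (L : ℝ) :
    Measurable (periodizedPotential v L) := by
  unfold periodizedPotential
  exact Measurable.tsum fun n => hv.comp (measurable_id.sub_const _).norm

/-- `∫_{cell^{n+1}} v^per(xᵢ - xⱼ) dX = (∫_{ℝ³} v(|x|)dx) · L^{3n}` for `i ≠ j` (slice integration in
`xᵢ`, unfolding of the periodisation on the cell). [folklore] -/
theorem lintegral_cellN_periodizedPotential_pair_slice (hv : Measurable v) {L : ℝ} (hL : 0 < L) {n : ℕ}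
    {i j : Fin (n + 1)} (hij : i ≠ j) :
    ∫⁻ X in cellN (n + 1) L, periodizedPotential v L (X i - X j) =
      (∫⁻ x : Space, v ‖x‖) * (ENNReal.ofReal L ^ 3) ^ n := by
  have hH : Measurable fun X : Config (n + 1) => periodizedPotential v L (X i - X j) :=
    (measurable_periodizedPotential' hv L).comp ((measurable_pi_apply i).sub (measurable_pi_apply j))
  have key := lintegral_cellN_lintegral_update (L := L) i hH
  have hinner : ∀ X : Config (n + 1),
      (∫⁻ x in cell L, periodizedPotential v L (Function.update X i x i - Function.update X i x j)) =
        ∫⁻ y : Space, v ‖y‖ := by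
    intro X
    simp only [Function.update_self, Function.update_of_ne hij.symm]
    exact lintegral_cell_periodizedPotential_sub hL hv (X j)
  simp only [hinner] at key
  rw [setLIntegral_const, volume_cellN, pow_succ, ← mul_assoc] at key
  have hV0 : (ENNReal.ofReal L ^ 3) ≠ 0 := pow_ne_zero _ ((ENNReal.ofReal_pos.2 hL).ne')
  have hVt : (ENNReal.ofReal L ^ 3) ≠ ⊤ := ENNReal.pow_ne_top ENNReal.ofReal_ne_top
  have key' : (ENNReal.ofReal L ^ 3) * ((∫⁻ y : Space, v ‖y‖) * (ENNReal.ofReal L ^ 3) ^ n) =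
      (ENNReal.ofReal L ^ 3) * ∫⁻ X in cellN (n + 1) L, periodizedPotential v L (X i - X j) := by
    rw [← key]; ring
  exact ((ENNReal.mul_right_inj hV0 hVt).1 key').symm

/-- **`E₀^per(n+1, L) ≤ ((n+1)²/L³) ∫_{ℝ³} v(|x|)dx`** by the constant trial state `Φ ≡ L^{-3(n+1)/2}`
(zero kinetic energy; each of the `≤ (n+1)²` pair terms costs `L⁻³∫ṽ`). [folklore] -/
theorem periodicGroundStateEnergy_le_const (hv : Measurable v) (n : ℕ) {L : ℝ} (hL : 0 < L) :
    periodicGroundStateEnergy v (n + 1) L ≤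
      ENNReal.ofReal (((n : ℝ) + 1) ^ 2 / L ^ 3) * ∫⁻ x : Space, v ‖x‖ := by
  set A : ℝ := (L ^ 3) ^ (n + 1) with hA
  have hLne : L ≠ 0 := hL.ne'
  have hL3 : 0 < L ^ 3 := by positivity
  have hApos : 0 < A := by positivity
  set c : ℝ := (Real.sqrt A)⁻¹ with hcdef
  have hc : ((‖(c : ℂ)‖₊ : ℝ≥0∞) ^ 2) = ENNReal.ofReal A⁻¹ := by
    rw [← ENNReal.coe_pow, ENNReal.ofReal, ENNReal.coe_inj]
    ext
    rw [NNReal.coe_pow, coe_nnnorm, Complex.norm_real, hcdef, norm_inv,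
      Real.norm_of_nonneg (Real.sqrt_nonneg _), inv_pow, Real.sq_sqrt hApos.le,
      Real.coe_toNNReal _ (by positivity)]
  have hvolA : (ENNReal.ofReal L ^ 3) ^ (n + 1) = ENNReal.ofReal A := by
    rw [hA, ← ENNReal.ofReal_pow hL.le, ← ENNReal.ofReal_pow hL3.le]
  let Φ : PeriodicTrialState (n + 1) L :=
    { ψ := fun _ => (c : ℂ)
      contDiff := contDiff_const
      periodic := fun _ _ _ => rfl
      symm := fun _ _ => rfl
      norm_eq := by
        rw [setLIntegral_const, volume_cellN, hc, hvolA, ← ENNReal.ofReal_mul (inv_nonneg.2 hApos.le),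
          inv_mul_cancel₀ hApos.ne', ENNReal.ofReal_one] }
  refine (periodicGroundStateEnergy_le v Φ).trans ?_
  -- the energy of the constant state
  have hkin : ∀ X : Config (n + 1), kineticDensity (fun _ : Config (n + 1) => (c : ℂ)) X = 0 := by
    intro X
    simp [kineticDensity]
  have hE : periodicEnergy v Φ =
      (∫⁻ X in cellN (n + 1) L, periodicInteraction v L X) * ENNReal.ofReal A⁻¹ := by
    unfold periodicEnergy
    rw [← lintegral_mul_const' _ _ ENNReal.ofReal_ne_top]
    refine lintegral_congr fun X => ?_
    change kineticDensity (fun _ : Config (n + 1) => (c : ℂ)) X +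
        periodicInteraction v L X * ((‖(c : ℂ)‖₊ : ℝ≥0∞) ^ 2) = _
    rw [hkin, zero_add, hc]
  -- the interaction integral: at most (n+1)² pair terms, each `∫ṽ · L^{3n}`
  set I : ℝ≥0∞ := ∫⁻ x : Space, v ‖x‖ with hI
  set V : ℝ≥0∞ := ENNReal.ofReal L ^ 3 with hV
  have hpair : ∀ i j : Fin (n + 1), i ≠ j →
      ∫⁻ X in cellN (n + 1) L, periodizedPotential v L (X i - X j) = I * V ^ n :=
    fun i j hij => lintegral_cellN_periodizedPotential_pair_slice hv hL hij
  have hmeas : ∀ i j : Fin (n + 1),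
      Measurable fun X : Config (n + 1) => periodizedPotential v L (X i - X j) := fun i j =>
    (measurable_periodizedPotential' hv L).comp ((measurable_pi_apply i).sub (measurable_pi_apply j))
  have hint : (∫⁻ X in cellN (n + 1) L, periodicInteraction v L X) ≤
      ((n + 1 : ℕ) : ℝ≥0∞) * (((n + 1 : ℕ) : ℝ≥0∞) * (I * V ^ n)) := by
    unfold periodicInteraction
    rw [lintegral_finsetSum _ fun i _ => Finset.measurable_sum _ fun j _ => hmeas i j]
    have hrow : ∀ i : Fin (n + 1),
        (∫⁻ X in cellN (n + 1) L, ∑ j : Fin (n + 1) with i < j, periodizedPotential v L (X i - X j)) ≤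
          ((n + 1 : ℕ) : ℝ≥0∞) * (I * V ^ n) := by
      intro i
      rw [lintegral_finsetSum _ fun j _ => hmeas i j]
      have hterm : ∀ j ∈ (Finset.univ.filter fun j : Fin (n + 1) => i < j),
          (∫⁻ X in cellN (n + 1) L, periodizedPotential v L (X i - X j)) = I * V ^ n := by
        intro j hj
        exact hpair i j (Finset.mem_filter.1 hj).2.ne
      rw [Finset.sum_congr rfl hterm, Finset.sum_const, nsmul_eq_mul]
      gcongr
      exact_mod_cast (Finset.card_filter_le _ _).trans (by simp)
    calc (∑ i : Fin (n + 1), ∫⁻ X in cellN (n + 1) L,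
            ∑ j : Fin (n + 1) with i < j, periodizedPotential v L (X i - X j))
        ≤ ∑ _i : Fin (n + 1), ((n + 1 : ℕ) : ℝ≥0∞) * (I * V ^ n) := Finset.sum_le_sum fun i _ => hrow i
      _ = ((n + 1 : ℕ) : ℝ≥0∞) * (((n + 1 : ℕ) : ℝ≥0∞) * (I * V ^ n)) := by
          rw [Finset.sum_const, nsmul_eq_mul, Finset.card_univ, Fintype.card_fin]
  rw [hE]
  calc (∫⁻ X in cellN (n + 1) L, periodicInteraction v L X) * ENNReal.ofReal A⁻¹
      ≤ ((n + 1 : ℕ) : ℝ≥0∞) * (((n + 1 : ℕ) : ℝ≥0∞) * (I * V ^ n)) * ENNReal.ofReal A⁻¹ :=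
        mul_le_mul' hint le_rfl
    _ = (((n + 1 : ℕ) : ℝ≥0∞) * ((n + 1 : ℕ) : ℝ≥0∞) * (V ^ n * ENNReal.ofReal A⁻¹)) * I := by ring
    _ = ENNReal.ofReal (((n : ℝ) + 1) ^ 2 / L ^ 3) * I := by
        congr 1
        rw [hV, ← ENNReal.ofReal_pow hL.le, ← ENNReal.ofReal_pow hL3.le,
          ← ENNReal.ofReal_mul (by positivity), ← ENNReal.ofReal_natCast,
          ← ENNReal.ofReal_mul (by positivity), ← ENNReal.ofReal_mul (by positivity)]
        congr 1
        rw [hA]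
        push_cast
        field_simp
        ring

/-- Along the thermodynamic sequence `L = (N/ρ)^{1/3}`: **`E₀^per ≤ ρ N ∫ṽ`**. [folklore] -/
theorem periodicGroundStateEnergy_sideLength_le (hv : Measurable v) {ρ : ℝ} (hρ : 0 < ρ) (n : ℕ) :
    periodicGroundStateEnergy v (n + 1) (sideLength ρ (n + 1)) ≤
      ENNReal.ofReal (ρ * ((n : ℝ) + 1)) * ∫⁻ x : Space, v ‖x‖ := by
  have hL : 0 < sideLength ρ (n + 1) := sideLength_pos_of_pos hρ (Nat.succ_pos n)
  have hN : (n : ℝ) + 1 ≠ 0 := by positivity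
  have hρne : ρ ≠ 0 := hρ.ne'
  refine (periodicGroundStateEnergy_le_const hv n hL).trans (le_of_eq ?_)
  congr 2
  rw [sideLength_pow_three hρ (n + 1)]
  push_cast
  field_simp

/-- For a finite smooth potential of finite range, `∫_{ℝ³} v(|x|) dx < ∞`. [folklore] -/
theorem lintegral_lt_top_of_smooth (hv : IsRepulsiveFiniteRange v) (hfin : ∀ r, v r ≠ ⊤)
    (hC : ContDiff ℝ 2 (fun x : Space => (v ‖x‖).toReal)) : (∫⁻ x : Space, v ‖x‖) < ⊤ := by
  obtain ⟨R₀, hR₀⟩ := hv.2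
  set f : Space → ℝ := fun x => (v ‖x‖).toReal with hf
  have hfc : Continuous f := hC.continuous
  have hfs : HasCompactSupport f := by
    refine HasCompactSupport.intro (isCompact_closedBall (0 : Space) R₀) fun x hx => ?_
    have hx' : R₀ < ‖x‖ := by
      rw [mem_closedBall, dist_zero_right] at hx
      exact lt_of_not_ge hx
    simp [hf, hR₀ _ hx']
  have hint : Integrable f volume := hfc.integrable_of_hasCompactSupport hfs
  have h0 : ∀ x, 0 ≤ f x := fun x => ENNReal.toReal_nonneg
  calc (∫⁻ x : Space, v ‖x‖) = ∫⁻ x : Space, ‖f x‖ₑ := by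
        refine lintegral_congr fun x => ?_
        rw [Real.enorm_eq_ofReal (h0 x)]
        simp only [hf]
        rw [ENNReal.ofReal_toReal (hfin _)]
    _ < ⊤ := hint.2

end EnergyUpperBound

/-! ## Puff's pair weight: measurability and `‖W‖₁ < ∞` -/

theorem continuous_puffWeightReal {v : ℝ → ℝ≥0∞} (hC : ContDiff ℝ 2 (fun x : Space => (v ‖x‖).toReal)) :
    Continuous fun y : Space => ‖y‖ ^ 2 * ‖iteratedFDeriv ℝ 2 (fun x : Space => (v ‖x‖).toReal) y‖ :=
  (continuous_norm.pow 2).mul (continuous_norm.comp (hC.continuous_iteratedFDeriv le_rfl))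

theorem measurable_puffWeight {v : ℝ → ℝ≥0∞} (hC : ContDiff ℝ 2 (fun x : Space => (v ‖x‖).toReal)) :
    Measurable (puffWeight v) :=
  ENNReal.measurable_ofReal.comp (continuous_puffWeightReal hC).measurable

/-- `‖W‖₁ < ∞`: `y ↦ |y|²‖D²ṽ(y)‖` is continuous with support in `B̄_{R₀}` (all derivatives of `ṽ` vanish off
`tsupport ṽ ⊆ B̄_{R₀}`). [folklore] -/
theorem lintegral_puffWeight_lt_top {v : ℝ → ℝ≥0∞} (hv : IsRepulsiveFiniteRange v)
    (hC : ContDiff ℝ 2 (fun x : Space => (v ‖x‖).toReal)) :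
    (∫⁻ y : Space, puffWeight v y) < ⊤ := by
  obtain ⟨R₀, hR₀⟩ := hv.2
  set g : Space → ℝ := fun x => (v ‖x‖).toReal with hg
  set f : Space → ℝ := fun y => ‖y‖ ^ 2 * ‖iteratedFDeriv ℝ 2 g y‖ with hf
  have hfc : Continuous f := continuous_puffWeightReal hC
  have hsupp : tsupport g ⊆ closedBall (0 : Space) R₀ := by
    refine closure_minimal (fun x hx => ?_) isClosed_closedBall
    rw [mem_closedBall, dist_zero_right]
    by_contra h
    exact hx (by simp [hg, hR₀ _ (lt_of_not_ge h)])
  have hzero : ∀ y : Space, R₀ < ‖y‖ → iteratedFDeriv ℝ 2 g y = 0 := by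
    intro y hy
    apply image_eq_zero_of_notMem_tsupport
    intro hmem
    have h1 := hsupp (tsupport_iteratedFDeriv_subset (𝕜 := ℝ) (n := 2) hmem)
    rw [mem_closedBall, dist_zero_right] at h1
    exact not_lt.2 h1 hy
  have hfs : HasCompactSupport f := by
    refine HasCompactSupport.intro (isCompact_closedBall (0 : Space) R₀) fun y hy => ?_
    have hy' : R₀ < ‖y‖ := by
      rw [mem_closedBall, dist_zero_right] at hy
      exact lt_of_not_ge hy
    simp [hf, hzero y hy']
  have hint : Integrable f volume := hfc.integrable_of_hasCompactSupport hfs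
  have h0 : ∀ y, 0 ≤ f y := fun y => by positivity
  calc (∫⁻ y : Space, puffWeight v y) = ∫⁻ y : Space, ‖f y‖ₑ := by
        refine lintegral_congr fun y => ?_
        rw [Real.enorm_eq_ofReal (h0 y)]
        rfl
    _ < ⊤ := hint.2

/-! ## Bose symmetry and unfolding of the periodisation for a VECTOR pair weight
(adapted from the tree's `lintegral_cellN_periodizedPotential_pair`, `…_periodicInteraction_mul_symm`,
`lintegral_cellN_periodizedPotential_mul` — same proofs with `v ‖·‖` replaced by `W ·`) -/

section VectorWeight

variable {L : ℝ}

theorem measurable_periodizedWeight {W : Space → ℝ≥0∞} (hW : Measurable W) (L : ℝ) :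
    Measurable (periodizedWeight W L) := by
  unfold periodizedWeight
  exact Measurable.tsum fun q => hW.comp (measurable_id.sub_const _)

/-- **Bose symmetry moves any pair to `(0,1)`** (vector weight). [folklore] -/
theorem lintegral_cellN_periodizedWeight_pair {m : ℕ} (W : Space → ℝ≥0∞) (L : ℝ)
    {G : Config (m + 2) → ℝ≥0∞}
    (hG : ∀ (σ : Equiv.Perm (Fin (m + 2))) (X : Config (m + 2)), G (X ∘ σ) = G X)
    {i j : Fin (m + 2)} (hij : i ≠ j) :
    ∫⁻ X in cellN (m + 2) L, periodizedWeight W L (X i - X j) * G X =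
      ∫⁻ X in cellN (m + 2) L, periodizedWeight W L (X 0 - X 1) * G X := by
  set σ : Equiv.Perm (Fin (m + 2)) := Equiv.swap 0 i * Equiv.swap 1 (Equiv.swap 0 i j) with hσ
  have hj' : Equiv.swap 0 i j ≠ 0 := by
    intro h
    rw [Equiv.swap_apply_eq_iff, Equiv.swap_apply_left] at h
    exact hij h.symm
  have h0 : σ 0 = i := by
    rw [hσ, Equiv.Perm.mul_apply, Equiv.swap_apply_of_ne_of_ne (Fin.zero_ne_one' (n := m + 1)) hj'.symm,
      Equiv.swap_apply_left]
  have h1 : σ 1 = j := by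
    rw [hσ, Equiv.Perm.mul_apply, Equiv.swap_apply_left, Equiv.swap_apply_self]
  calc ∫⁻ X in cellN (m + 2) L, periodizedWeight W L (X i - X j) * G X
      = ∫⁻ X in cellN (m + 2) L,
          (fun Y : Config (m + 2) => periodizedWeight W L (Y 0 - Y 1) * G Y) (X ∘ σ) := by
        refine lintegral_congr fun X => ?_
        simp only [Function.comp_apply, h0, h1, hG]
    _ = ∫⁻ X in cellN (m + 2) L, periodizedWeight W L (X 0 - X 1) * G X :=
        lintegral_cellN_comp_perm σ (fun Y : Config (m + 2) => periodizedWeight W L (Y 0 - Y 1) * G Y)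

/-- **The weighted pair sum of a Bose-symmetric density is `C(N,2)` times one pair** (vector weight). [folklore] -/
theorem lintegral_cellN_pairWeightSum_mul_symm {m : ℕ} {W : Space → ℝ≥0∞} (hW : Measurable W)
    (L : ℝ) {G : Config (m + 2) → ℝ≥0∞} (hGm : Measurable G)
    (hG : ∀ (σ : Equiv.Perm (Fin (m + 2))) (X : Config (m + 2)), G (X ∘ σ) = G X) :
    ∫⁻ X in cellN (m + 2) L, pairWeightSum W L X * G X =
      (((m + 2).choose 2 : ℕ) : ℝ≥0∞) *
        ∫⁻ X in cellN (m + 2) L, periodizedWeight W L (X 0 - X 1) * G X := by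
  have hmeas : ∀ i j : Fin (m + 2), Measurable fun X : Config (m + 2) => periodizedWeight W L (X i - X j) :=
    fun i j => (measurable_periodizedWeight hW L).comp ((measurable_pi_apply i).sub (measurable_pi_apply j))
  unfold pairWeightSum
  simp_rw [Finset.sum_mul]
  rw [lintegral_finsetSum _ fun i _ => Finset.measurable_sum _ fun j _ => (hmeas i j).fun_mul hGm]
  have hin : ∀ i : Fin (m + 2), ∫⁻ X in cellN (m + 2) L,
      ∑ j : Fin (m + 2) with i < j, periodizedWeight W L (X i - X j) * G X =
      ∑ j : Fin (m + 2) with i < j, ∫⁻ X in cellN (m + 2) L, periodizedWeight W L (X 0 - X 1) * G X := by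
    intro i
    rw [lintegral_finsetSum _ fun j _ => (hmeas i j).fun_mul hGm]
    refine Finset.sum_congr rfl fun j hj => ?_
    exact lintegral_cellN_periodizedWeight_pair W L hG (Finset.mem_filter.1 hj).2.ne
  simp_rw [hin]
  exact sum_sum_lt_const _

/-- **Unfolding the periodisation of a vector pair weight** (tiling of `ℝ³` by the translates of `Λ`, in the first
particle): for a measurable `H ≥ 0` on `Λ^{m+2}` that is `Lℤ³`-periodic in the first particle,
`∫_{Λ^{m+2}} W^per(x₀ − x₁) H(X) dX = ∫_{x₀ ∈ ℝ³} ∫_{X' ∈ Λ^{m+1}} W(x₀ − x₁) H(x₀ :: X') dx₀ dX'`. [folklore] -/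
theorem lintegral_cellN_periodizedWeight_mul (hL : 0 < L) {W : Space → ℝ≥0∞} (hW : Measurable W)
    {m : ℕ} {H : Config (m + 2) → ℝ≥0∞} (hH : Measurable H)
    (hper : ∀ (x : Space) (X' : Config (m + 1)) (n : Fin 3 → ℤ),
      H (Fin.cons (x + latticeVec L n) X') = H (Fin.cons x X')) :
    ∫⁻ X in cellN (m + 2) L, periodizedWeight W L (X 0 - X 1) * H X =
      ∫⁻ X, W (X 0 - X 1) * H X ∂(hybridMeasure L m) := by
  have hmp := measurePreserving_piFinSuccAbove
    (fun _ : Fin (m + 2) => (volume : Measure Space).restrict (cell L)) 0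
  rw [volume_restrict_cellN, hmp.symm.lintegral_map_equiv, ← volume_restrict_cellN,
    (measurePreserving_hybrid_split L m).symm.lintegral_map_equiv]
  have hsymm : ∀ z : Space × Config (m + 1),
      (MeasurableEquiv.piFinSuccAbove (fun _ : Fin (m + 2) => Space) 0).symm z = Fin.cons z.1 z.2 :=
    fun z => piFinSuccAbove_symm_apply_cons z.1 z.2
  simp only [hsymm]
  have h0 : ∀ z : Space × Config (m + 1), (Fin.cons z.1 z.2 : Config (m + 2)) 0 = z.1 := fun z => rfl
  have h1 : ∀ z : Space × Config (m + 1), (Fin.cons z.1 z.2 : Config (m + 2)) 1 = z.2 0 := fun z => rfl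
  simp only [h0, h1]
  have hmeasH : Measurable fun z : Space × Config (m + 1) => H (Fin.cons z.1 z.2) := hH.comp measurable_cons
  have hsub : Measurable fun z : Space × Config (m + 1) => z.1 - z.2 0 :=
    measurable_fst.sub ((measurable_pi_apply 0).comp measurable_snd)
  have hmeas1 : Measurable fun z : Space × Config (m + 1) =>
      periodizedWeight W L (z.1 - z.2 0) * H (Fin.cons z.1 z.2) := by
    refine Measurable.mul ?_ hmeasH
    unfold periodizedWeight
    exact Measurable.tsum fun n => hW.comp (hsub.sub measurable_const)
  have hmeas2 : Measurable fun z : Space × Config (m + 1) => W (z.1 - z.2 0) * H (Fin.cons z.1 z.2) :=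
    (hW.comp hsub).mul hmeasH
  rw [lintegral_prod_symm _ hmeas1.aemeasurable, lintegral_prod_symm _ hmeas2.aemeasurable]
  refine lintegral_congr fun X' => ?_
  have hinner : ∀ x : Space, periodizedWeight W L (x - X' 0) * H (Fin.cons x X') =
      ∑' n : Fin 3 → ℤ, W (x - latticeVec L n - X' 0) * H (Fin.cons (x - latticeVec L n) X') := by
    intro x
    rw [periodizedWeight, ← ENNReal.tsum_mul_right]
    refine tsum_congr fun n => ?_
    have hH' : H (Fin.cons (x - latticeVec L n) X') = H (Fin.cons x X') := by
      have := hper (x - latticeVec L n) X' n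
      rw [sub_add_cancel] at this
      exact this.symm
    rw [hH', sub_right_comm]
  simp only [hinner]
  rw [lintegral_tsum fun n => ?_]
  · exact tsum_lintegral_cell_sub_latticeVec hL (fun u => W (u - X' 0) * H (Fin.cons u X'))
  · refine Measurable.aemeasurable ?_
    exact ((hW.comp ((measurable_id.sub measurable_const).sub measurable_const))).mul
      (hH.comp (measurable_cons.comp ((measurable_id.sub measurable_const).prodMk measurable_const)))

end VectorWeight

/-! ## The pair moment from the pair-density node (shear + Tonelli) -/

/-- `Fin.cons (x + e) X' = Fin.cons x X' + e ⊗ δ₀`. [folklore] -/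
theorem cons_add_eq_add_single {m : ℕ} (x e : Space) (X' : Config (m + 1)) :
    (Fin.cons (x + e) X' : Config (m + 2)) =
      (Fin.cons x X' : Config (m + 2)) + Pi.single (0 : Fin (m + 2)) e := by
  funext i
  refine Fin.cases ?_ (fun j => ?_) i
  · simp
  · simp

/-- A periodic trial state is `Lℤ³`-periodic in the first particle of `x :: X'`. [folklore] -/
theorem psi_cons_add_latticeVec {m : ℕ} {L : ℝ} (Ψ : PeriodicTrialState (m + 2) L)
    (x : Space) (X' : Config (m + 1)) (n : Fin 3 → ℤ) :
    Ψ.ψ (Fin.cons (x + latticeVec L n) X') = Ψ.ψ (Fin.cons x X') := by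
  have hax : ∀ (y : Space) (k : Fin 3),
      (fun y : Space => Ψ.ψ (Fin.cons y X')) (y + EuclideanSpace.single k L) =
        (fun y : Space => Ψ.ψ (Fin.cons y X')) y := by
    intro y k
    show Ψ.ψ (Fin.cons (y + EuclideanSpace.single k L) X') = Ψ.ψ (Fin.cons y X')
    rw [cons_add_eq_add_single, Ψ.periodic]
  exact periodic_latticeVec (φ := fun y : Space => Ψ.ψ (Fin.cons y X')) hax x n

/-- `X' ↦ (x + X'₀) :: X'` is continuous. [folklore] -/
theorem continuous_consShift {m : ℕ} (x : Space) :
    Continuous fun X' : Config (m + 1) => (Fin.cons (x + X' 0) X' : Config (m + 2)) := by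
  refine continuous_pi fun i => ?_
  refine Fin.cases ?_ (fun j => ?_) i
  · simp only [Fin.cons_zero]
    exact continuous_const.add (continuous_apply 0)
  · simp only [Fin.cons_succ]
    exact continuous_apply j

/-- **Pair moment from bounded bunching** (PROVED; the step gen 1 kept inside a stub). For ANY measurable vector
weight `W ≥ 0`, any periodic trial state `Ψ` of `m+2` bosons on the torus of side `L > 0`, and any `C ≥ 0` with
`L³ G(r) ≤ C` for every separation `r`, where `G(r) = ∫_{cell^{m+1}} |Ψ(X₀ + r, X₀, X₁, …)|²` is the
translation-averaged pair density:
`∫_{cell^{m+2}} ∑_{i<j} W^per(xᵢ − xⱼ) |Ψ|² ≤ C(m+2, 2) · (C/L³) · ∫_{ℝ³} W`.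
Proof: Bose symmetry moves every pair to `(0,1)`, the periodisation unfolds in the first particle, the shear
`(x₀, X') ↦ (x₀ + X'₀) :: X'` decouples the pair (`measurePreserving_consShear`), Tonelli, and the inner
integral is `G(x₀) ≤ C/L³`. [folklore; LSSY2005 App. A (A.10) for the unfolding] -/
theorem pairMoment_le_of_pairDensity (W : Space → ℝ≥0∞) (hW : Measurable W)
    {L : ℝ} (hL : 0 < L) {m : ℕ} (Ψ : PeriodicTrialState (m + 2) L) {C : ℝ} (hC : 0 ≤ C)
    (hG : ∀ r : Space,
      L ^ 3 * (∫ X in cellN (m + 1) L, ‖Ψ.ψ (Matrix.vecCons (X 0 + r) X)‖ ^ 2) ≤ C) :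
    ∫⁻ X in cellN (m + 2) L, pairWeightSum W L X * (‖Ψ.ψ X‖₊ : ℝ≥0∞) ^ 2 ≤
      (((m + 2).choose 2 : ℕ) : ℝ≥0∞) * (ENNReal.ofReal (C / L ^ 3) * ∫⁻ y : Space, W y) := by
  set G : Config (m + 2) → ℝ≥0∞ := fun X => (‖Ψ.ψ X‖₊ : ℝ≥0∞) ^ 2 with hGdef
  have hψm : Measurable Ψ.ψ := Ψ.contDiff.continuous.measurable
  have hGm : Measurable G := (hψm.nnnorm.coe_nnreal_ennreal).pow_const 2
  have hGsymm : ∀ (σ : Equiv.Perm (Fin (m + 2))) (X : Config (m + 2)), G (X ∘ σ) = G X := by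
    intro σ X
    simp only [hGdef, Ψ.symm]
  have hGper : ∀ (x : Space) (X' : Config (m + 1)) (n : Fin 3 → ℤ),
      G (Fin.cons (x + latticeVec L n) X') = G (Fin.cons x X') := by
    intro x X' n
    simp only [hGdef, psi_cons_add_latticeVec]
  rw [lintegral_cellN_pairWeightSum_mul_symm hW L hGm hGsymm,
    lintegral_cellN_periodizedWeight_mul hL hW hGm hGper]
  refine mul_le_mul' le_rfl ?_
  -- shear `(x₀, X') ↦ (x₀ + X'₀) :: X'`
  have hΦ := measurePreserving_consShear L m
  have hf : Measurable fun X : Config (m + 2) => W (X 0 - X 1) * G X :=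
    (hW.comp ((measurable_pi_apply 0).sub (measurable_pi_apply 1))).mul hGm
  rw [← hΦ.lintegral_comp hf]
  have h01 : ∀ z : Space × Config (m + 1),
      (Fin.cons (z.1 + z.2 0) z.2 : Config (m + 2)) 0 - (Fin.cons (z.1 + z.2 0) z.2 : Config (m + 2)) 1 = z.1 :=
    fun z => add_sub_cancel_right z.1 (z.2 0)
  simp only [h01]
  -- Tonelli
  have hcons : Measurable fun z : Space × Config (m + 1) => (Fin.cons (z.1 + z.2 0) z.2 : Config (m + 2)) :=
    hΦ.measurable
  have hf2 : Measurable fun z : Space × Config (m + 1) => W z.1 * G (Fin.cons (z.1 + z.2 0) z.2) :=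
    (hW.comp measurable_fst).mul (hGm.comp hcons)
  rw [lintegral_prod _ hf2.aemeasurable]
  -- the inner integral is `G(x₀) ≤ C/L³`
  have hinner : ∀ x : Space,
      (∫⁻ X' in cellN (m + 1) L, G (Fin.cons (x + X' 0) X')) ≤ ENNReal.ofReal (C / L ^ 3) := by
    intro x
    have hcont : Continuous fun X' : Config (m + 1) => ‖Ψ.ψ (Fin.cons (x + X' 0) X')‖ ^ 2 :=
      (continuous_norm.comp (Ψ.contDiff.continuous.comp (continuous_consShift x))).pow 2
    have hint : IntegrableOn (fun X' : Config (m + 1) => ‖Ψ.ψ (Fin.cons (x + X' 0) X')‖ ^ 2)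
        (cellN (m + 1) L) volume :=
      Theorems.PuffFloor.Negative.integrableOn_cellN_real L hcont
    have hnn : 0 ≤ᵐ[volume.restrict (cellN (m + 1) L)]
        fun X' : Config (m + 1) => ‖Ψ.ψ (Fin.cons (x + X' 0) X')‖ ^ 2 :=
      Eventually.of_forall fun _ => by positivity
    have heq : (∫⁻ X' in cellN (m + 1) L, G (Fin.cons (x + X' 0) X')) =
        ENNReal.ofReal (∫ X' in cellN (m + 1) L, ‖Ψ.ψ (Fin.cons (x + X' 0) X')‖ ^ 2) := by
      rw [ofReal_integral_eq_lintegral_ofReal hint hnn]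
      refine lintegral_congr fun X' => ?_
      simp only [hGdef]
      rw [ENNReal.ofReal_pow (norm_nonneg _), ofReal_norm, enorm_eq_nnnorm]
    rw [heq]
    refine ENNReal.ofReal_le_ofReal ?_
    have h := hG x
    have hfun : (fun X : Config (m + 1) => ‖Ψ.ψ (Matrix.vecCons (X 0 + x) X)‖ ^ 2) =
        fun X' => ‖Ψ.ψ (Fin.cons (x + X' 0) X')‖ ^ 2 := by
      funext X
      rw [add_comm (X 0) x]
      rfl
    rw [hfun] at h
    rw [le_div_iff₀ (pow_pos hL 3), mul_comm]
    exact h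
  have hconsx : ∀ x : Space, Measurable fun X' : Config (m + 1) => G (Fin.cons (x + X' 0) X') :=
    fun x => hGm.comp (continuous_consShift x).measurable
  calc ∫⁻ x : Space, ∫⁻ X' in cellN (m + 1) L, W x * G (Fin.cons (x + X' 0) X')
      = ∫⁻ x : Space, W x * ∫⁻ X' in cellN (m + 1) L, G (Fin.cons (x + X' 0) X') := by
        refine lintegral_congr fun x => ?_
        rw [lintegral_const_mul _ (hconsx x)]
    _ ≤ ∫⁻ x : Space, W x * ENNReal.ofReal (C / L ^ 3) :=
        lintegral_mono fun x => mul_le_mul' le_rfl (hinner x)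
    _ = ENNReal.ofReal (C / L ^ 3) * ∫⁻ y : Space, W y := by
        rw [lintegral_mul_const _ hW, mul_comm]

/-! ## Arithmetic of the composition -/

/-- `C(N,2) ≤ N²/2` in `ℝ≥0∞`. [folklore] -/
theorem choose_two_le_ofReal (N : ℕ) :
    ((N.choose 2 : ℕ) : ℝ≥0∞) ≤ ENNReal.ofReal ((N : ℝ) ^ 2 / 2) := by
  rw [← ENNReal.ofReal_natCast]
  refine ENNReal.ofReal_le_ofReal ?_
  have h : ((N.choose 2 : ℕ) : ℝ) ≤ (N : ℝ) ^ 2 / (Nat.factorial 2 : ℕ) := Nat.choose_le_pow_div 2 N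
  norm_num [Nat.factorial] at h
  exact h

/-- `ENNReal` bookkeeping: from `a ≤ ofReal x` and `b ≤ ofReal y` (`x, y ≥ 0`), `12 a + 2 b ≤ ofReal (12 x + 2 y)`.
[folklore] -/
theorem twelve_add_two_le {a b : ℝ≥0∞} {x y : ℝ} (hx : 0 ≤ x) (hy : 0 ≤ y)
    (ha : a ≤ ENNReal.ofReal x) (hb : b ≤ ENNReal.ofReal y) :
    12 * a + 2 * b ≤ ENNReal.ofReal (12 * x + 2 * y) := by
  rw [ENNReal.ofReal_add (by positivity) (by positivity), ENNReal.ofReal_mul (by norm_num),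
    ENNReal.ofReal_mul (by norm_num), ENNReal.ofReal_ofNat, ENNReal.ofReal_ofNat]
  gcongr

/-- The pair-moment frame (the currency of S7 and of the composition): `P ≤ C ρ N` for the crux's minimisers,
eventually in `n`, for `ρ < ρ₀`. -/
def PairMomentFrame (v : ℝ → ℝ≥0∞) : Prop :=
  ∃ C : ℝ, 0 ≤ C ∧ ∃ ρ₀ : ℝ, 0 < ρ₀ ∧ ∀ ρ : ℝ, 0 < ρ → ρ < ρ₀ → ∀ᶠ n : ℕ in Filter.atTop,
    ∀ Ψ : PeriodicTrialState (n + 1) (sideLength ρ (n + 1)),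
      periodicEnergy v Ψ = periodicGroundStateEnergy v (n + 1) (sideLength ρ (n + 1)) →
      periodicEnergy v Ψ ≠ ⊤ → (∀ X, Ψ.ψ X = (‖Ψ.ψ X‖ : ℂ)) → (∀ X, Ψ.ψ X ≠ 0) →
      (∫⁻ X in cellN (n + 1) (sideLength ρ (n + 1)),
          pairWeightSum (puffWeight v) (sideLength ρ (n + 1)) X * (‖Ψ.ψ X‖₊ : ℝ≥0∞) ^ 2) ≤
        ENNReal.ofReal (C * ρ * ((n : ℝ) + 1))

/-- **Solid cores: the pair moment from the node** (PROVED): S1 (regularity) + `PairDensityBoundSolid` + the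
transfer `pairMoment_le_of_pairDensity`, with the index shift `N = k + 2 ↔ n + 1` and
`C(N,2)·(C_G/L³)·‖W‖₁ ≤ (C_G‖W‖₁/2)·ρ·N`. -/
theorem pairMomentFrame_of_solidCore (hreg : MinimiserRegularity) (hnode : PairDensityBoundSolid)
    (v : ℝ → ℝ≥0∞) (hv : IsRepulsiveFiniteRange v) (hfin : ∀ r, v r ≠ ⊤)
    (hC2 : ContDiff ℝ 2 (fun x : Space => (v ‖x‖).toReal))
    (hedge : ∃ Cₑ : ℝ, ∀ x : Space,
      ‖iteratedFDeriv ℝ 2 (fun x : Space => (v ‖x‖).toReal) x‖ ≤ Cₑ * Real.sqrt ((v ‖x‖).toReal))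
    (hcore : 0 < v 0) : PairMomentFrame v := by
  obtain ⟨CG, hCG0, ρ₀, hρ₀, hN⟩ := hnode v hv hfin hC2 hedge hcore
  have hJtop : (∫⁻ y : Space, puffWeight v y) ≠ ⊤ := (lintegral_puffWeight_lt_top hv hC2).ne
  set J : ℝ := (∫⁻ y : Space, puffWeight v y).toReal with hJ
  have hJ0 : 0 ≤ J := ENNReal.toReal_nonneg
  refine ⟨CG * J / 2, by positivity, ρ₀, hρ₀, fun ρ hρ hρlt => ?_⟩
  have hk := hN ρ hρ hρlt
  rw [Filter.eventually_atTop] at hk ⊢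
  obtain ⟨K, hK⟩ := hk
  refine ⟨K + 1, fun n hn => ?_⟩
  obtain ⟨k, rfl⟩ : ∃ k, n = k + 1 := ⟨n - 1, by omega⟩
  have hKk := hK k (by omega)
  intro Ψ hmin hfinE hreal hne
  have hLpos : 0 < sideLength ρ (k + 1 + 1) := sideLength_pos_of_pos hρ (Nat.succ_pos (k + 1))
  have hC3 : ContDiff ℝ 3 Ψ.ψ :=
    hreg v hv hfin hC2 hedge (k + 1) (sideLength ρ (k + 1 + 1)) hLpos Ψ hmin hfinE hreal hne
  have hGb : ∀ r : Space, sideLength ρ (k + 1 + 1) ^ 3 *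
      (∫ X in cellN (k + 1) (sideLength ρ (k + 1 + 1)), ‖Ψ.ψ (Matrix.vecCons (X 0 + r) X)‖ ^ 2) ≤ CG :=
    hKk Ψ hmin hfinE hC3 hreal hne
  have hP := pairMoment_le_of_pairDensity (puffWeight v) (measurable_puffWeight hC2) hLpos (m := k) Ψ hCG0 hGb
  refine hP.trans ?_
  rw [← ENNReal.ofReal_toReal hJtop, ← hJ]
  refine (mul_le_mul' (choose_two_le_ofReal (k + 2)) le_rfl).trans (le_of_eq ?_)
  rw [← ENNReal.ofReal_mul (by positivity), ← ENNReal.ofReal_mul (by positivity)]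
  congr 1
  have hdens : (((k + 1 + 1 : ℕ) : ℝ)) / sideLength ρ (k + 1 + 1) ^ 3 = ρ :=
    div_sideLength_pow_three hρ (Nat.succ_pos (k + 1))
  have hcast : ((k + 2 : ℕ) : ℝ) = ((k + 1 + 1 : ℕ) : ℝ) := by push_cast; ring
  calc ((k + 2 : ℕ) : ℝ) ^ 2 / 2 * (CG / sideLength ρ (k + 1 + 1) ^ 3 * J)
      = ((k + 1 + 1 : ℕ) : ℝ) * ((((k + 1 + 1 : ℕ) : ℝ)) / sideLength ρ (k + 1 + 1) ^ 3) * CG * J / 2 := by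
        rw [hcast]; ring
    _ = CG * J / 2 * ρ * (((k + 1 : ℕ) : ℝ) + 1) := by rw [hdens]; push_cast; ring

/-- Solid cores by the node, coreless members by the shared residual S7: the pair-moment frame for the WHOLE smooth
class (case split on `0 < v 0` in `ℝ≥0∞`). -/
theorem pairMomentFrame_all (hreg : MinimiserRegularity) (hnode : PairDensityBoundSolid)
    (hres : CorelessPairMoment)
    (v : ℝ → ℝ≥0∞) (hv : IsRepulsiveFiniteRange v) (hfin : ∀ r, v r ≠ ⊤)
    (hC2 : ContDiff ℝ 2 (fun x : Space => (v ‖x‖).toReal))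
    (hedge : ∃ Cₑ : ℝ, ∀ x : Space,
      ‖iteratedFDeriv ℝ 2 (fun x : Space => (v ‖x‖).toReal) x‖ ≤ Cₑ * Real.sqrt ((v ‖x‖).toReal)) :
    PairMomentFrame v := by
  rcases eq_zero_or_pos (v 0) with h0 | h0
  · exact hres v hv hfin hC2 hedge h0
  · exact pairMomentFrame_of_solidCore hreg hnode v hv hfin hC2 hedge h0

/-! ## The skeleton concludes the crux BY NAME -/

/-- **Composition.** `PuffFloor` (route `BECConjugateDomination`, stmt-AtomisticToContinuum-11785) from the seven
registered stubs: for a smooth-class `v` the pair-moment frame (node route for solid cores, S7 for coreless ones)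
gives `C_P, ρ₀`; with `C := 12‖ṽ‖₁ + 2C_P`, for `ρ < ρ₀` and eventually in `N = n+1`, the crux's minimiser `Ψ`
is `C³` (S1), `2P ≤ 2C_PρN`, the constant trial state bounds `12T ≤ 12E₀ ≤ 12‖ṽ‖₁ρN`, and the engine S6 with
`Θ = Cρ` is the floor. No `sorry` of its own. -/
theorem PuffFloor_of : PuffFloor := by
  intro v hv hfin hC2 hedge
  obtain ⟨CP, hCP0, ρ₀, hρ₀, hPM⟩ := pairMomentFrame_all minimiserRegularity_holds pairDensityBoundSolid
    corelessPairMoment_holds v hv hfin hC2 hedge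
  have hItop : (∫⁻ x : Space, v ‖x‖) ≠ ⊤ := (lintegral_lt_top_of_smooth hv hfin hC2).ne
  set I : ℝ := (∫⁻ x : Space, v ‖x‖).toReal with hI
  have hI0 : 0 ≤ I := ENNReal.toReal_nonneg
  refine ⟨12 * I + 2 * CP, by positivity, ρ₀, hρ₀, fun ρ hρ hρlt => ?_⟩
  filter_upwards [hPM ρ hρ hρlt] with n hn Ψ
  intro L S kn hmin hfinE hreal hne m hm
  have hLpos : 0 < L := sideLength_pos_of_pos hρ (Nat.succ_pos n)
  have hC3 : ContDiff ℝ 3 Ψ.ψ := stub_minimiserRegularity v hv hfin hC2 hedge n L hLpos Ψ hmin hfinE hreal hne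
  -- the pair moment `P ≤ C_P ρ N` (node route or S7)
  have hP : (∫⁻ X in cellN (n + 1) L, pairWeightSum (puffWeight v) L X * (‖Ψ.ψ X‖₊ : ℝ≥0∞) ^ 2) ≤
      ENNReal.ofReal (CP * ρ * ((n : ℝ) + 1)) := hn Ψ hmin hfinE hreal hne
  -- density bookkeeping `N/L³ = ρ`
  have hdens : ((n : ℝ) + 1) / L ^ 3 = ρ := by
    have h := div_sideLength_pow_three hρ (Nat.succ_pos n)
    push_cast at h
    exact h
  -- `T ≤ E(Ψ) = E₀ ≤ (N²/L³) ‖ṽ‖₁ = ‖ṽ‖₁ ρ N`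
  have hE : periodicEnergy v Ψ ≤ ENNReal.ofReal (I * ρ * ((n : ℝ) + 1)) := by
    rw [hmin]
    refine (periodicGroundStateEnergy_le_const hv.1 n hLpos).trans (le_of_eq ?_)
    rw [← ENNReal.ofReal_toReal hItop, ← hI, ← ENNReal.ofReal_mul (by positivity)]
    congr 1
    calc ((n : ℝ) + 1) ^ 2 / L ^ 3 * I = ((n : ℝ) + 1) * (((n : ℝ) + 1) / L ^ 3) * I := by ring
      _ = I * ρ * ((n : ℝ) + 1) := by rw [hdens]; ring
  have hT : (∫⁻ X in cellN (n + 1) L, kineticDensity Ψ.ψ X) ≤ ENNReal.ofReal (I * ρ * ((n : ℝ) + 1)) :=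
    le_trans (lintegral_mono fun X => le_self_add) hE
  have key := twelve_add_two_le (by positivity) (by positivity) hT hP
  have hring : 12 * (I * ρ * ((n : ℝ) + 1)) + 2 * (CP * ρ * ((n : ℝ) + 1)) =
      (12 * I + 2 * CP) * ρ * ((n : ℝ) + 1) := by ring
  rw [hring] at key
  exact stub_puffFeynmanFloor v hv hfin hC2 n L hLpos Ψ hC3 hmin hfinE hreal
    ((12 * I + 2 * CP) * ρ) (by positivity) key m hm

end Summit.AtomisticToContinuum.BoseEinsteinCondensation.Cruxes.PuffFloor.PairSubsolutionRemovalEnergy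

end
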